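import Literature.AlgebraicGeometry.Motives.LinesGenerateChowOnePlane
import Literature.AlgebraicGeometry.Motives.SubschemeCyclesPushPullProofs
import Literature.AlgebraicGeometry.Motives.ProjectiveSpaceFieldPointsFunctorial
import Literature.AlgebraicGeometry.Motives.HirschowitzIyerParameterCurve
import Literature.RingTheory.MvPolynomial.TwoPointLineChainsCr
import Mathlib.FieldTheory.IsAlgClosed.AlgebraicClosure
import Mathlib.FieldTheory.IntermediateField.Adjoin.Basic
import Mathlib.GroupTheory.Torsion
import HarnessLib

/-!
# `CH₁(X)` is generated by lines up to torsion when `Σ (2 dᵢ - 1) ≤ N` (Tian–Zong's product trick over finite extensions)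

Tian–Zong, *One-cycles on rationally connected varieties* (Compositio Math. 150 (2014)), proof of
Thm. 6.1 (= Thm. 1.7, the named fact `TianZong2014_chowOne_generatedByLines`), first step: for a
complete intersection `X` rationally chain connected by lines, "`CH₀(F(X)) ⊗ ℚ → CH₁(X) ⊗ ℚ` is
surjective (Proposition 3.13.3, Chap. IV [Kollár])", proved in the paper's language by the
**product trick** of §7 (Prop. 7.1: "after a base change `S → C` there is a rational curve in
`X ×_C K(S)` connecting `Γ ×_C K(S)` and `C' ×_C K(S)`. Thus there is a ruled surface with two
sections … two sections of a ruled surface are rationally equivalent modulo fibers … The result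
follows from pushing forward everything to `X` and the fact that the push-forward of `C'` is `0`").
This file formalizes that step for chains of two LINES, where it is elementary and explicit:

**Theorem** (`exists_pos_smul_mem_closure_lineClasses`,
`ProjFamily.exists_pos_smul_primeCycle_ratEquiv_lines`). Let `k` be algebraically closed and
`X ⊆ ℙᴺ_k` a closed subscheme with underlying set `V₊(F₁, …, F_c)`, `F_a` forms of degrees
`d_a ≥ 1` with `Σ_a (2 d_a - 1) ≤ N`. Then for every integral curve `C ⊆ X` some positive multiple
`e [C]` is rationally equivalent to an integral combination of lines of `X`; hence every class of
`CH₁(X)` has a positive multiple in the subgroup generated by the line classes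
(`CH₁(X) ⊗ ℚ` is spanned by lines; `isTorsion_chowGroupOne_quot_lineClasses`).

Proof. Let `K = k(C)`; the generic point of `C` and a closed point `x₀ ∈ X` are `K`-points `[p]`,
`[q]` of `X_K`. The middle points `r` of chains of two lines `p r`, `r q` on `X` are the zeros of
`Σ_a (2 (d_a - 1) + 1) ≤ N` forms (`Literature.RingTheory.MvPolynomial.TwoPointLineChainsCr`), so
over the algebraic closure of `K` there is one (projective dimension theorem,
`isCrSystem_zero_of_isAlgClosed`), defined over a finite extension `E/K`
(`ProjFamily.exists_finite_extension_two_line_chain`). Let `Z` be the normalisation of `C` in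
`E` — a proper regular curve over `k` with `k(Z) = E`, built in
`Motives/HirschowitzIyerParameterCurve` from `Resolution/NormalizationInExtension`
(`ProjFamily.exists_ringEquiv_of_presentation` extracts the field isomorphism `k(Z) ≃ E` over `k`
from the preimmersion `Spec E → Z`). Over `Z` the two lines sweep ruled surfaces in `X ×ₖ Z` on
which the two sections are rationally equivalent modulo vertical lines
(`ProjFamily.exists_relation_of_line`, `Motives/RuledSurfaceRelation`). Push forward along the
proper projection `X ×ₖ Z → X` (Fulton Thm. 1.4): the section through `p` maps onto `C` with
coefficient `e = [κ : κ(C)] ≠ 0` — non-zero because the section and `C` have the same dimension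
(dimension formula, `ProjFamily.mapCoeff_ne_zero_of_height_eq`); the section through `q` is
contracted; the middle sections cancel. Hence `e [C] ∈ Σ ℤ [lines] + Rat₁(X)`.

For the named fact (`Σ d_a ≤ N - 1`, INTEGRAL coefficients) this gives the rational-coefficient
statement in the range `2 Σ d_a - c ≤ N` — e.g. smooth cubic hypersurfaces of dimension `≥ 4`,
`(2, 3)` complete intersections in `ℙᴺ` for `N ≥ 8` — complementing the integral results of
`Motives/LinesGenerateChowOneSumSq` (`Σ d_a² ≤ N`) and `Motives/LinesGenerateChowOnePlane`; the
integral statement needs in addition Tian–Zong's Prop. 3.1 (divisibility and boundedness of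
`CH₁(X)_alg`) and Thms. 1.3, 6.2, which are not in the tree.

Everything here is proved; the only definition is the saturation `AddSubgroup.posSmulSaturation`
(`{x | ∃ e > 0, e • x ∈ H}`).

## References

* [TianZong2014] Z. Tian, H. R. Zong, *One-cycles on rationally connected varieties*, Compositio
  Math. 150 (2014), Prop. 7.1 and its proof, proof of Prop. 7.2, proof of Thm. 6.1, Prop. 3.1.
* [Fulton1998] W. Fulton, *Intersection Theory*, Thm. 1.4, §1.4.
* [Liu2002] Q. Liu, *Algebraic Geometry and Arithmetic Curves*, Def. 4.1.24, Prop. 4.1.27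
  (normalisation in a finite extension, `K(X') = L`).
* [StacksProject] The Stacks Project, Tag 02JW (dimension formula).
-/

noncomputable section

open CategoryTheory CategoryTheory.Limits AlgebraicGeometry MonoidalCategory MvPolynomial
  TopologicalSpace Order

universe u

namespace Literature.AlgebraicGeometry.Motives

attribute [local instance] MvPolynomial.gradedAlgebra MvPolynomial.algebraMvPolynomial
  Literature.AlgebraicGeometry.Motives.ProjBaseChange.algebraBase
  UniversalHyperplaneSection.sectionsAlgebra ProjFamily.functionFieldAlgebra

namespace ProjFamily

open ProjBaseChangeRing ProjectiveSpaceCells ProjectiveSpace Literature.RingTheory.MvPolynomial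
  Literature.FieldTheory.QuasiAlgClosed

variable {k : Type u} [Field k]

/-! ### Algebra: a two-line chain over a finite extension of `K` -/

section Descent

variable {K : Type u} [Field K] {N : ℕ}

omit [Field k] in
/-- Evaluation commutes with extension of scalars: `(φF)(φ ∘ x) = φ(F(x))`. [folklore] -/
theorem eval_comp_map {K' : Type u} [CommRing K'] (φ : K →+* K') (x : Fin (N + 1) → K)
    (P : MvPolynomial (Fin (N + 1)) K) :
    eval (φ ∘ x) (MvPolynomial.map φ P) = φ (eval x P) := by
  rw [MvPolynomial.eval_map, show eval x P = eval₂ (RingHom.id K) x P from rfl,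
    MvPolynomial.eval₂_comp_left, RingHom.comp_id]

omit [Field k] in
/-- A ring map applied to `s • x + t • y` coordinatewise. [folklore] -/
theorem comp_smul_add_smul {K' : Type u} [CommRing K'] (φ : K →+* K') (s t : K)
    (x y : Fin (N + 1) → K) :
    φ ∘ (s • x + t • y) = φ s • (φ ∘ x) + φ t • (φ ∘ y) := by
  funext j
  simp only [Function.comp_apply, Pi.add_apply, Pi.smul_apply, smul_eq_mul, map_add, map_mul]

/-- The degree count `Σ_a (2 (d_a - 1) + 1)` of the two-line-chain system over an algebraically closed
field (`r = 0` in `exists_two_line_chain_of_isCrSystem`: the NUMBER of equations). [folklore] -/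
theorem sum_pow_zero_count {c : ℕ} (d : Fin c → ℕ) :
    ∑ a, (2 * ∑ i : Fin (d a - 1), (d a - 1 - (i : ℕ)) ^ 0 + d a ^ 0) = ∑ a, (2 * (d a - 1) + 1) := by
  refine Finset.sum_congr rfl fun a _ => ?_
  simp

omit [Field k] in
/-- **A chain of two lines through two zeros, over a finite extension.** Let `F_a` be forms of degrees
`d_a ≥ 1` in `N + 1` variables over a field `K` with `Σ_a (2 d_a - 1) ≤ N`, and `p, q` common zeros.
Over the algebraic closure `Ω` of `K` the scheme of middle points of the chains of two lines `p r`,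
`r q` on `V(F)` is cut out by `Σ_a (2 d_a - 1) ≤ N` homogeneous equations in `ℙᴺ`, hence has a
point (`exists_two_line_chain_of_isCrSystem` with the projective dimension theorem,
`isCrSystem_zero_of_isAlgClosed`); its coordinates generate a finite extension `E` of `K` inside `Ω`.
So: there are a finite extension `E/K` and `m ∈ E^{N+1}`, `m ≠ 0`, with
`F_a(s p + t m) = F_a(s q + t m) = 0` for all `s, t ∈ E`. [cite: TianZong2014, proof of Prop. 7.1]
[folklore] -/
theorem exists_finite_extension_two_line_chain {c : ℕ} {F : Fin c → MvPolynomial (Fin (N + 1)) K}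
    {d : Fin c → ℕ} (hF : ∀ a, (F a).IsHomogeneous (d a)) (hd : ∀ a, 0 < d a)
    (hcount : ∑ a, (2 * (d a - 1) + 1) < N + 1) {p q : Fin (N + 1) → K}
    (hp : ∀ a, eval p (F a) = 0) (hq : ∀ a, eval q (F a) = 0) :
    ∃ (E : IntermediateField K (AlgebraicClosure K)), FiniteDimensional K E ∧
      ∃ m : Fin (N + 1) → E, m ≠ 0 ∧ ∀ a (s t : E),
        eval (s • ((algebraMap K E) ∘ p) + t • m) (MvPolynomial.map (algebraMap K E) (F a)) = 0 ∧
        eval (s • ((algebraMap K E) ∘ q) + t • m) (MvPolynomial.map (algebraMap K E) (F a)) = 0 := by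
  classical
  let Ω := AlgebraicClosure K
  -- the middle point over `Ω`
  have hFΩ : ∀ a, (MvPolynomial.map (algebraMap K Ω) (F a)).IsHomogeneous (d a) :=
    fun a => (hF a).map _
  have hpΩ : ∀ a, eval ((algebraMap K Ω) ∘ p) (MvPolynomial.map (algebraMap K Ω) (F a)) = 0 :=
    fun a => by rw [eval_comp_map, hp a, map_zero]
  have hqΩ : ∀ a, eval ((algebraMap K Ω) ∘ q) (MvPolynomial.map (algebraMap K Ω) (F a)) = 0 :=
    fun a => by rw [eval_comp_map, hq a, map_zero]
  obtain ⟨r, hr0, hr⟩ := exists_two_line_chain_of_isCrSystem (isCrSystem_zero_of_isAlgClosed Ω)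
    hFΩ hd (by rw [sum_pow_zero_count]; exact hcount) hpΩ hqΩ
  -- the finite extension generated by its coordinates
  let E : IntermediateField K Ω := IntermediateField.adjoin K (Set.range r)
  haveI : Finite ↥(Set.range r) := Set.finite_range r |>.to_subtype
  have hfin : FiniteDimensional K E :=
    IntermediateField.finiteDimensional_adjoin fun x _ =>
      (Algebra.IsAlgebraic.isAlgebraic (R := K) x).isIntegral
  have hmem : ∀ j, r j ∈ E := fun j => IntermediateField.subset_adjoin K _ ⟨j, rfl⟩
  let m : Fin (N + 1) → E := fun j => ⟨r j, hmem j⟩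
  have hmval : (algebraMap E Ω) ∘ m = r := funext fun j => rfl
  refine ⟨E, hfin, m, fun hm0 => hr0 ?_, fun a s t => ⟨?_, ?_⟩⟩
  · rw [← hmval, hm0]
    funext j
    exact map_zero _
  · apply (algebraMap E Ω).injective
    rw [map_zero, ← eval_comp_map, comp_smul_add_smul, hmval, MvPolynomial.map_map,
      ← IsScalarTower.algebraMap_eq]
    have hpc : (algebraMap (↥E) Ω) ∘ ((algebraMap K E) ∘ p) = (algebraMap K Ω) ∘ p := by
      funext j
      exact (IsScalarTower.algebraMap_apply K E Ω (p j)).symm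
    rw [hpc]
    exact (hr a _ _).1
  · apply (algebraMap E Ω).injective
    rw [map_zero, ← eval_comp_map, comp_smul_add_smul, hmval, MvPolynomial.map_map,
      ← IsScalarTower.algebraMap_eq]
    have hqc : (algebraMap (↥E) Ω) ∘ ((algebraMap K E) ∘ q) = (algebraMap K Ω) ∘ q := by
      funext j
      exact (IsScalarTower.algebraMap_apply K E Ω (q j)).symm
    rw [hqc]
    exact (hr a _ _).2

end Descent

/-! ### The function field of a curve presented by a finite extension -/

section Presentation

variable (B : SchemeOver k) [IsIntegral B.left] {F' : Type u} [Field F'] [Algebra k F']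

/-- **`K(B) ≅ F'` from a presentation of the generic point.** If `g : Spec F' → B` is a preimmersion
over `k` onto the generic point (e.g. `Spec L → X^L` for the normalisation of `X` in a finite
extension `L`, Liu Def. 4.1.24: "`K(X') = L`"), then there is a ring isomorphism
`θ : K(B) ≃ F'` with `Spec θ ≫ (Spec K(B) → B) = g` and compatible with the `k`-structures.
[cite: Liu2002, Def. 4.1.24] [folklore] -/
theorem exists_ringEquiv_of_presentation (g : specOver k F' ⟶ B) [IsPreimmersion g.left]
    (hg : g.left.base (IsLocalRing.closedPoint F') = genericPoint B.left) :
    ∃ θ : B.left.functionField ≃+* F',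
      Spec.map (CommRingCat.ofHom θ.toRingHom) ≫ qgen B = g.left ∧
        θ.toRingHom.comp (algebraMap k B.left.functionField) = algebraMap k F' := by
  -- the underlying morphism `Spec F' → B` and its structure equation
  let g' : Spec (CommRingCat.of F') ⟶ B.left := g.left
  haveI : IsPreimmersion g' := ‹IsPreimmersion g.left›
  have hg' : g'.base (IsLocalRing.closedPoint F') = genericPoint B.left := hg
  have hw : g' ≫ B.hom = Spec.map (CommRingCat.ofHom (algebraMap k F')) := Over.w g
  -- the ring map `K(B) = 𝒪_{B,η} → 𝒪_{B, g(pt)} → F'`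
  let e : B.left.functionField ≅ B.left.presheaf.stalk (g'.base (IsLocalRing.closedPoint F')) :=
    B.left.presheaf.stalkCongr (Inseparable.of_eq hg'.symm)
  let θ₀ : B.left.presheaf.stalk (g'.base (IsLocalRing.closedPoint F')) ⟶ CommRingCat.of F' :=
    Scheme.stalkClosedPointTo g'
  let θh : B.left.functionField ⟶ CommRingCat.of F' := e.hom ≫ θ₀
  have hθ : Spec.map θh ≫ qgen B = g' := by
    rw [Spec.map_comp, Category.assoc]
    change Spec.map θ₀ ≫ Spec.map e.hom ≫ B.left.fromSpecStalk (genericPoint B.left) = _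
    rw [TopCat.Presheaf.stalkCongr_hom, Scheme.SpecMap_stalkSpecializes_fromSpecStalk]
    exact Scheme.Spec_stalkClosedPointTo_fromSpecStalk g'
  -- bijectivity
  have hsurj : Function.Surjective θh.hom := by
    change Function.Surjective (θ₀.hom ∘ e.hom.hom)
    refine Function.Surjective.comp ?_ e.commRingCatIsoToRingEquiv.surjective
    change Function.Surjective ((g'.stalkMap (IsLocalRing.closedPoint F') ≫
      (stalkClosedPointIso (CommRingCat.of F')).hom).hom)
    exact (stalkClosedPointIso (CommRingCat.of F')).commRingCatIsoToRingEquiv.surjective.comp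
      (g'.stalkMap_surjective _)
  have hinj : Function.Injective θh.hom := θh.hom.injective
  let θ : B.left.functionField ≃+* F' := RingEquiv.ofBijective θh.hom ⟨hinj, hsurj⟩
  have hθeq : CommRingCat.ofHom θ.toRingHom = θh := rfl
  refine ⟨θ, by rw [hθeq]; exact hθ, ?_⟩
  -- compatibility with `k`: both composites to `Spec k` agree
  have hcomp : Spec.map θh ≫ (qgen B ≫ B.hom) = Spec.map (CommRingCat.ofHom (algebraMap k F')) := by
    rw [← Category.assoc, hθ]
    exact hw
  rw [qgen_comp_hom, ← Spec.map_comp] at hcomp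
  have h2 := Spec.map_injective hcomp
  exact congrArg (fun f => f.hom) h2

end Presentation

/-! ### Push-forward coefficients from dimensions -/

section Coefficient

/-- **Points of the same dimension as their image have finite residue extension.** Over a field,
if `dim closure {x} = dim closure {f x}` (finite) then the push-forward coefficient
`[κ(x) : κ(f x)]` of `f_*` at `x` is non-zero: by the dimension formula
`dim x = dim (f x) + dim_{fibre} x` (Stacks 02JW) `x` is closed in its fibre, so its residue
extension is finite (Stacks 01TB). [cite: StacksProject, Tag 02JW] [folklore] -/
theorem mapCoeff_ne_zero_of_height_eq {X Y : Scheme.{u}} (f : X ⟶ Y)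
    (q : Y ⟶ Spec (CommRingCat.of k)) [LocallyOfFiniteType f] [LocallyOfFiniteType q] (x : X)
    {n : ℕ} (hx : height x = n) (hfx : height (f.base x) = n) :
    AlgebraicCycle.mapCoeff f height height x ≠ 0 := by
  rw [mapCoeff_height_eq_residueDegree f q x]
  apply residueDegree_ne_zero_of_height_asFiber_eq_zero
  have h := Scheme.height_eq_height_add_height_asFiber f q x
  rw [hx, hfx] at h
  have h' : (n : ℕ∞) + height (f.asFiber x) = n + 0 := by rw [add_zero]; exact h.symm
  exact ENat.add_right_injective_of_ne_top (ENat.coe_ne_top n) h'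

end Coefficient

/-! ### Points of the generic fibre with given coordinates -/

section Points

variable {N : ℕ}

/-- The underlying point of `[z]_L ∈ ℙᴺ_L(L)` maps to that of `[z] ∈ ℙᴺ_k(L)` under the base-change
morphism `ℙᴺ_L → ℙᴺ_k` (pointwise `pointOfVec_left_comp_projMap`). [folklore] -/
theorem projMap_pt_pointOfVec {L : Type u} [Field L] [Algebra k L] (z : Fin (N + 1) → L)
    (hz : z ≠ 0) :
    (Proj.map (mapGraded k L (Fin (N + 1))) (irrelevant_le_map k L (Fin (N + 1)))).base
        (pointOfVec L z hz).pt = (pointOfVec k z hz).pt := by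
  have h := congrArg (fun f => f.base (IsLocalRing.closedPoint L))
    (pointOfVec_left_comp_projMap (k := k) z hz)
  simp only [Scheme.Hom.comp_base, TopCat.coe_comp, Function.comp_apply] at h
  exact h

variable (B : SchemeOver k) [IsIntegral B.left] (X : SchemeOver k) (i : X ⟶ projectiveSpace N k)

/-- **The point of `X` under a point of `X_K` with coordinates from `L ⊆ K`.** If `u ∈ X_K` has
homogeneous coordinates `φ ∘ z` for a `k`-algebra map `φ : L → K` and `z ∈ Lᴺ⁺¹`, then
`i (pr₁ (ι u))` is the underlying point of `[z] ∈ ℙᴺ_k(L)`. [folklore] -/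
theorem i_fst_ιX_eq_pt_pointOfVec {L : Type u} [Field L] [Algebra k L]
    (φ : L →ₐ[k] B.left.functionField) (z : Fin (N + 1) → L) (hz : z ≠ 0) (u : ↥(XK B X))
    (hu : (iK N B X i).base u = (pointOfVec B.left.functionField (φ ∘ z) (comp_ne_zero φ hz)).pt) :
    i.left.base ((CartesianMonoidalCategory.fst X B).left.base ((ιX B X).base u)) =
      (pointOfVec k z hz).pt := by
  rw [i_fst_ιX_apply, hu, projMap_pt_pointOfVec, pt_pointOfVec_comp_algHom φ z hz]

end Points

/-! ### The relation `e · [C] ~ Σ nᵢ [ℓᵢ]` over the normalisation of `C` in a finite extension -/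

section MainRat

variable [IsAlgClosed k] {N : ℕ} (X : SchemeOver k) (i : X ⟶ projectiveSpace N k)
  [IsClosedImmersion i.left]

set_option maxHeartbeats 400000 in
/-- **A positive multiple of every curve class is an integral combination of lines** when
`Σ_a (2 d_a - 1) ≤ N` (Tian–Zong's product trick over a finite extension of the function field —
the first step, "`CH₀(F(X)) ⊗ ℚ → CH₁(X) ⊗ ℚ` is surjective", of the proof of Thm. 6.1, for
complete intersections where two points are joined by a chain of two lines). Let
`X = V₊(F) ⊆ ℙᴺ_k` be closed, `F` of degrees `d_a ≥ 1`, `k` algebraically closed,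
`Σ_a (2 d_a - 1) ≤ N`, and `C = closure {z₀}` an integral curve on `X` with function field `K`. The
generic point `[p]` of `C` and a closed point `[q]` are `K`-points of `X_K`; over the algebraic
closure of `K` they are joined by a chain of two lines (`Σ (2 d_a - 1) ≤ N` equations in `ℙᴺ`,
`exists_finite_extension_two_line_chain`), defined over a finite extension `E/K`. On the
normalisation `Z` of `C` in `E` (`Motives/HirschowitzIyerParameterCurve`; `K(Z) = E`,
`exists_ringEquiv_of_presentation`) the two lines sweep ruled surfaces in `X ×ₖ Z` on which the
sections are rationally equivalent modulo vertical lines (`exists_relation_of_line`); pushing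
forward to `X`, the section through `p` gives `e [C]` with `e = [κ : κ(z₀)] ≠ 0`
(`mapCoeff_ne_zero_of_height_eq`), the section through `q` is contracted, and the middle sections
cancel: `e [C] ∈ Σ ℤ [lines] + Rat₁(X)` with `e > 0`.
[cite: TianZong2014, Prop. 3.1, Prop. 7.1 and proof of Thm. 6.1] -/
theorem exists_pos_smul_primeCycle_ratEquiv_lines (hN : 1 ≤ N)
    {c : ℕ} (F : Fin c → MvPolynomial (Fin (N + 1)) k) (d : Fin c → ℕ)
    (hFhom : ∀ b, (F b).IsHomogeneous (d b)) (hd : ∀ b, 0 < d b)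
    (hrange : Set.range i.left.base =
      ProjectiveSpectrum.zeroLocus (homogeneousSubmodule (Fin (N + 1)) k) (Set.range F))
    (hcount : ∑ b, (2 * (d b - 1) + 1) < N + 1) (z₀ : ↥X.left) (hz : height z₀ = 1) :
    ∃ e : ℕ, 0 < e ∧ ∃ (s : Finset ↥X.left) (w : ↥X.left → ℤ), (∀ y ∈ s, IsLinePoint N i y) ∧
      IsRationallyEquivalent ((e : ℤ) • primeCycle z₀) (∑ y ∈ s, w y • primeCycle y) 1 := by
  classical
  -- instances on `X`
  haveI : IsProper (projectiveSpace N k).hom := isProper_projectiveSpace N k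
  haveI : IsProper X.hom := by rw [← Over.w i]; infer_instance
  -- the curve `W = closure {z₀}` over `k` and its generic point as a `K`-point of `X`
  let W : SchemeOver k := curveOf z₀
  let aW : Spec W.left.functionField ⟶ X.left := qgen W ≫ (ClosedSubvariety.ofPoint X.left z₀).ι
  have haW : aW ≫ X.hom = qgen W ≫ W.hom := by
    simp only [aW, Category.assoc]
    rfl
  have hqgenW : (qgen W).base (IsLocalRing.closedPoint W.left.functionField) = genericPoint W.left := by
    have h : (qgen W).base (IsLocalRing.closedPoint W.left.functionField) ∈ Set.range (qgen W).base :=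
      ⟨_, rfl⟩
    rwa [range_qgen, Set.mem_singleton_iff] at h
  have haWpt : aW.base (IsLocalRing.closedPoint W.left.functionField) = z₀ := by
    change (ClosedSubvariety.ofPoint X.left z₀).ι.base ((qgen W).base _) = z₀
    rw [hqgenW]
    exact ClosedSubvariety.genericPoint_ofPoint z₀
  -- a closed point `x₀` of `X` below `z₀` and the constant `K`-point at `x₀`
  obtain ⟨x₀, hx₀lt⟩ : ∃ x₀, x₀ < z₀ := by
    have h : ¬ IsMin z₀ := fun hmin => by
      have := Order.height_eq_zero.mpr hmin
      rw [hz] at this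
      exact one_ne_zero this
    simpa [not_isMin_iff] using h
  have hx₀0 : height x₀ = 0 := by
    have h := height_strictMono hx₀lt (by
      refine lt_of_le_of_lt (height_mono hx₀lt.le) ?_
      rw [hz]; exact ENat.coe_lt_top 1)
    rw [hz] at h
    exact Order.lt_one_iff.mp h
  have hx₀ : IsClosed ({x₀} : Set ↥X.left) := isClosed_singleton_of_height_eq_zero' hx₀0
  let a₀W : Spec W.left.functionField ⟶ X.left :=
    qgen W ≫ W.hom ≫ pointOfClosedPoint X.hom x₀ hx₀
  have ha₀W : a₀W ≫ X.hom = qgen W ≫ W.hom := by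
    simp only [a₀W, Category.assoc, pointOfClosedPoint_comp, Category.comp_id]
  have ha₀Wpt : a₀W.base (IsLocalRing.closedPoint W.left.functionField) = x₀ :=
    pointOfClosedPoint_apply X.hom x₀ hx₀ _
  -- homogeneous coordinates `p, q ∈ Kᴺ⁺¹`
  obtain ⟨p, hp0, hPp⟩ := exists_eq_pointOfVec (algPt N W X i aW haW)
  obtain ⟨q, hq0, hPq⟩ := exists_eq_pointOfVec (algPt N W X i a₀W ha₀W)
  have hptp : (pointOfVec W.left.functionField p hp0).pt = uPt N W X i aW haW := by
    rw [← hPp]; rfl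
  have hptq : (pointOfVec W.left.functionField q hq0).pt = uPt N W X i a₀W ha₀W := by
    rw [← hPq]; rfl
  have hFmem : ∀ (a' : Spec W.left.functionField ⟶ X.left) (ha' : a' ≫ X.hom = qgen W ≫ W.hom) b,
      MvPolynomial.map (algebraMap k W.left.functionField) (F b) ∈
        ProjectiveSpectrum.asHomogeneousIdeal
          (𝒜 := homogeneousSubmodule (Fin (N + 1)) W.left.functionField) (uPt N W X i a' ha') := by
    intro a' ha' b
    refine map_mem_asHomogeneousIdeal_uPt N W X i a' ha' ?_
    have hmem : i.left.base (a'.base (IsLocalRing.closedPoint W.left.functionField)) ∈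
        Set.range i.left.base := ⟨_, rfl⟩
    rw [hrange] at hmem
    exact hmem ⟨b, rfl⟩
  have hFp : ∀ b, eval p (MvPolynomial.map (algebraMap k W.left.functionField) (F b)) = 0 :=
    fun b => eval_eq_zero_of_mem_asHomogeneousIdeal_pt_pointOfVec hp0 (hd b) ((hFhom b).map _)
      (hptp ▸ hFmem aW haW b)
  have hFq : ∀ b, eval q (MvPolynomial.map (algebraMap k W.left.functionField) (F b)) = 0 :=
    fun b => eval_eq_zero_of_mem_asHomogeneousIdeal_pt_pointOfVec hq0 (hd b) ((hFhom b).map _)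
      (hptq ▸ hFmem a₀W ha₀W b)
  -- the images of `[p]`, `[q]` in `ℙᴺ_k` are `i z₀`, `i x₀`
  have hip : (pointOfVec k p hp0).pt = i.left.base z₀ := by
    rw [← projMap_pt_pointOfVec, hptp, ← i_apply_eq_projMap_uPt N W X i aW haW, haWpt]
  have hiq : (pointOfVec k q hq0).pt = i.left.base x₀ := by
    rw [← projMap_pt_pointOfVec, hptq, ← i_apply_eq_projMap_uPt N W X i a₀W ha₀W, ha₀Wpt]
  -- a chain of two lines over a finite extension `E` of `K`
  obtain ⟨E, hEfin, m, hm0, hm⟩ := exists_finite_extension_two_line_chain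
    (F := fun b => MvPolynomial.map (algebraMap k W.left.functionField) (F b)) (d := d)
    (fun b => (hFhom b).map _) hd hcount hFp hFq
  haveI : FiniteDimensional W.left.functionField E := hEfin
  -- the normalisation `Z` of `W` in `E`
  let Z : SchemeOver k := paramCurve z₀ (↥E)
  have hZ1 : height (genericPoint Z.left) = 1 := by
    rw [height_genericPoint_paramCurve]; exact hz
  have hpid : ∀ b : Z.left, IsClosed ({b} : Set Z.left) →
      IsPrincipalIdealRing (Z.left.presheaf.stalk b) := by
    intro b hb
    have hne : b ≠ genericPoint Z.left := fun h => by
      have h0 := height_eq_zero_of_isClosed_singleton hb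
      rw [h, hZ1] at h0
      exact one_ne_zero h0
    haveI := isDiscreteValuationRing_stalk_paramCurve z₀ (↥E) hz hne
    infer_instance
  -- `K(Z) ≅ E` and the `k`-algebra map `ψ : K → K(Z)`
  let g : specOver k (↥E) ⟶ Z := paramGen z₀ (↥E)
  have hg : g.left.base (IsLocalRing.closedPoint (↥E)) = genericPoint Z.left := by
    have h : g.left.base (IsLocalRing.closedPoint (↥E)) ∈ Set.range g.left.base := ⟨_, rfl⟩
    have hr : Set.range g.left.base = {genericPoint Z.left} := range_paramGen z₀ (↥E)
    rw [hr] at h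
    exact h
  obtain ⟨θ, -, hθ2⟩ := exists_ringEquiv_of_presentation Z g hg
  have hθ2' : ∀ x, θ (algebraMap k Z.left.functionField x) = algebraMap k (↥E) x :=
    fun x => RingHom.congr_fun hθ2 x
  let ψ : W.left.functionField →ₐ[k] Z.left.functionField :=
    { toRingHom := θ.symm.toRingHom.comp (algebraMap W.left.functionField (↥E))
      commutes' := fun x => by
        change θ.symm (algebraMap W.left.functionField (↥E) (algebraMap k W.left.functionField x)) =
          algebraMap k Z.left.functionField x
        rw [← IsScalarTower.algebraMap_apply k W.left.functionField (↥E) x, ← hθ2' x,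
          RingEquiv.symm_apply_apply] }
  -- the three vectors over `K(Z)`
  let pZ : Fin (N + 1) → Z.left.functionField := ψ ∘ p
  let qZ : Fin (N + 1) → Z.left.functionField := ψ ∘ q
  let mZ : Fin (N + 1) → Z.left.functionField := fun j => θ.symm (m j)
  have hpZ0 : pZ ≠ 0 := comp_ne_zero ψ hp0
  have hqZ0 : qZ ≠ 0 := comp_ne_zero ψ hq0
  have hmZ0 : mZ ≠ 0 := by
    intro h0
    apply hm0
    funext j
    have hj : θ.symm (m j) = 0 := congrFun h0 j
    exact θ.symm.injective (hj.trans (map_zero θ.symm).symm)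
  -- the relations over `K(Z)` (transported along `θ`)
  have hmapθ : ∀ b, MvPolynomial.map θ.toRingHom
      (MvPolynomial.map (algebraMap k Z.left.functionField) (F b)) =
      MvPolynomial.map (algebraMap W.left.functionField (↥E))
        (MvPolynomial.map (algebraMap k W.left.functionField) (F b)) := by
    intro b
    rw [MvPolynomial.map_map, MvPolynomial.map_map, hθ2,
      IsScalarTower.algebraMap_eq k W.left.functionField (↥E)]
  have hθp : ⇑θ.toRingHom ∘ pZ = ⇑(algebraMap W.left.functionField (↥E)) ∘ p :=
    funext fun j => θ.apply_symm_apply _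
  have hθq : ⇑θ.toRingHom ∘ qZ = ⇑(algebraMap W.left.functionField (↥E)) ∘ q :=
    funext fun j => θ.apply_symm_apply _
  have hθm : ⇑θ.toRingHom ∘ mZ = m := funext fun j => θ.apply_symm_apply _
  have hrel : ∀ b (s t : Z.left.functionField),
      eval (s • pZ + t • mZ) (MvPolynomial.map (algebraMap k Z.left.functionField) (F b)) = 0 ∧
      eval (s • qZ + t • mZ) (MvPolynomial.map (algebraMap k Z.left.functionField) (F b)) = 0 := by
    intro b s t
    constructor
    · apply θ.toRingHom.injective
      rw [map_zero, ← eval_comp_map θ.toRingHom, comp_smul_add_smul, hmapθ, hθp, hθm]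
      exact (hm b _ _).1
    · apply θ.toRingHom.injective
      rw [map_zero, ← eval_comp_map θ.toRingHom, comp_smul_add_smul, hmapθ, hθq, hθm]
      exact (hm b _ _).2
  -- instances on `X ×ₖ Z`
  haveI : LocallyOfFiniteType (X ⊗ Z).hom :=
    inferInstanceAs (LocallyOfFiniteType (pullback.fst X.hom Z.hom ≫ X.hom))
  haveI : IsProper (CartesianMonoidalCategory.fst X Z).left :=
    inferInstanceAs (IsProper (pullback.fst X.hom Z.hom))
  haveI : QuasiCompact (X ⊗ Z).hom :=
    inferInstanceAs (QuasiCompact (pullback.fst X.hom Z.hom ≫ X.hom))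
  haveI : CompactSpace ↥(X ⊗ Z).left := compactSpace_of_quasiCompact_hom (X ⊗ Z)
  haveI : LocallyOfFiniteType ((CartesianMonoidalCategory.fst X Z).left ≫ X.hom) :=
    inferInstanceAs (LocallyOfFiniteType (X ⊗ Z).hom)
  haveI : LocallyOfFiniteType (CartesianMonoidalCategory.fst X Z).left :=
    inferInstanceAs (LocallyOfFiniteType (pullback.fst X.hom Z.hom))
  haveI := infinite_functionField (k := k) Z
  have hP := isPullback_ιX Z X
  have hi := range_qgen Z
  -- points of `X_{K(Z)}` with rational coordinates: dimension of their closure in `X × Z`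
  have hh1 : ∀ (u : ↥(XK Z X)) (v : Fin (N + 1) → Z.left.functionField) (hv : v ≠ 0),
      (iK N Z X i).base u = (pointOfVec Z.left.functionField v hv).pt →
        height ((ιX Z X).base u) = 1 := by
    intro u v hv hu
    let V : ClosedSubvariety (XK Z X) := ClosedSubvariety.ofPoint _ u
    have hdim := dim_image_eq hP hi hZ1 V
    have hV : V.dim = 0 := by
      change height V.genericPoint = 0
      rw [ClosedSubvariety.genericPoint_ofPoint, ← height_base_eq_of_isClosedImmersion' (iK N Z X i),
        hu]
      exact height_pt _
    have hI : (V.image (ιX Z X)).dim = height ((ιX Z X).base u) := by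
      change height (V.image (ιX Z X)).genericPoint = _
      rw [ClosedSubvariety.genericPoint_image, ClosedSubvariety.genericPoint_ofPoint]
    rw [← hI, hdim, hV]
    rfl
  -- … over `[p]`: they lie over `z₀`
  have hfst_p : ∀ u : ↥(XK Z X),
      (iK N Z X i).base u = (pointOfVec Z.left.functionField pZ hpZ0).pt →
      (CartesianMonoidalCategory.fst X Z).left.base ((ιX Z X).base u) = z₀ := by
    intro u hu
    apply i.left.isClosedEmbedding.injective
    rw [i_fst_ιX_eq_pt_pointOfVec Z X i ψ p hp0 u hu, hip]
  -- … over `[q]`: they lie over the closed point `x₀`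
  have hfst_q : ∀ u : ↥(XK Z X),
      (iK N Z X i).base u = (pointOfVec Z.left.functionField qZ hqZ0).pt →
      (CartesianMonoidalCategory.fst X Z).left.base ((ιX Z X).base u) = x₀ := by
    intro u hu
    apply i.left.isClosedEmbedding.injective
    rw [i_fst_ιX_eq_pt_pointOfVec Z X i ψ q hq0 u hu, hiq]
  -- push-forward along `pr₁ : X × Z → X`
  let M : AlgebraicCycle (X ⊗ Z).left ℤ →+ AlgebraicCycle X.left ℤ :=
    AddMonoidHom.mk' (AlgebraicCycle.map (CartesianMonoidalCategory.fst X Z).left height height)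
      (algebraicCycleMap_add _ height height)
  have hMrat : ∀ c' ∈ ratTrivial (X ⊗ Z).left 1, M c' ∈ ratTrivial X.left 1 :=
    fun c' hc' => map_mem_ratTrivial_holds (d := 1) (CartesianMonoidalCategory.fst X Z) hc'
  -- (i) a section through `p` pushes forward to `e [z₀]`, `e ≠ 0`
  have hMp : ∀ u : ↥(XK Z X),
      (iK N Z X i).base u = (pointOfVec Z.left.functionField pZ hpZ0).pt →
      ∃ e : ℕ, e ≠ 0 ∧ M (primeCycle ((ιX Z X).base u)) = (e : ℤ) • primeCycle z₀ := by
    intro u hu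
    refine ⟨AlgebraicCycle.mapCoeff (CartesianMonoidalCategory.fst X Z).left height height
      ((ιX Z X).base u), ?_, ?_⟩
    · exact mapCoeff_ne_zero_of_height_eq (CartesianMonoidalCategory.fst X Z).left X.hom _
        (hh1 u pZ hpZ0 hu) (by rw [hfst_p u hu, hz, Nat.cast_one])
    · change AlgebraicCycle.map (CartesianMonoidalCategory.fst X Z).left height height _ = _
      rw [algebraicCycleMap_primeCycle_eq_nsmul, natCast_zsmul, hfst_p u hu]
  -- (ii) a section through `q` pushes forward to `0`
  have hMq : ∀ u : ↥(XK Z X),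
      (iK N Z X i).base u = (pointOfVec Z.left.functionField qZ hqZ0).pt →
      M (primeCycle ((ιX Z X).base u)) = 0 := by
    intro u hu
    change AlgebraicCycle.map (CartesianMonoidalCategory.fst X Z).left height height _ = _
    rw [algebraicCycleMap_primeCycle_eq_nsmul]
    have hne : height ((ιX Z X).base u) ≠
        height ((CartesianMonoidalCategory.fst X Z).left.base ((ιX Z X).base u)) := by
      rw [hh1 u qZ hqZ0 hu, hfst_q u hu, hx₀0]; exact one_ne_zero
    rw [AlgebraicCycle.mapCoeff, if_neg hne, zero_smul]
  -- (iii) vertical parts push forward to cycles supported on lines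
  have key_line : ∀ V : AlgebraicCycle (X ⊗ Z).left ℤ,
      (∀ z, V z ≠ 0 → IsLinePoint N i ((CartesianMonoidalCategory.fst X Z).left.base z)) →
      ∃ s : Finset ↥X.left, (∀ y ∈ s, IsLinePoint N i y) ∧ Function.support (M V) ⊆ s := by
    intro V hV
    refine ⟨(finite_support_of_compactSpace V).toFinset.image
      (CartesianMonoidalCategory.fst X Z).left.base, ?_, ?_⟩
    · intro y hy
      rw [Finset.mem_image] at hy
      obtain ⟨z, hz', rfl⟩ := hy
      exact hV z (Function.mem_support.mp ((Set.Finite.mem_toFinset _).mp hz'))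
    · exact support_map_subset _ V _ (by rw [Set.Finite.coe_toFinset])
  -- reduction to a relation `M c' = e [z₀] + M V` in `X × Z`
  suffices h : ∃ e : ℕ, e ≠ 0 ∧ ∃ c' ∈ ratTrivial (X ⊗ Z).left 1,
      ∃ V : AlgebraicCycle (X ⊗ Z).left ℤ,
        M c' = (e : ℤ) • primeCycle z₀ + M V ∧
          ∀ z, V z ≠ 0 → IsLinePoint N i ((CartesianMonoidalCategory.fst X Z).left.base z) by
    obtain ⟨e, he, c', hc', V, hMc', hV⟩ := h
    obtain ⟨s, hs, hsupp⟩ := key_line V hV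
    refine ⟨e, Nat.pos_of_ne_zero he, s, fun y => -((M V) y), hs, ?_⟩
    change (e : ℤ) • primeCycle z₀ - ∑ y ∈ s, (-((M V) y)) • primeCycle y ∈ ratTrivial X.left 1
    have hsum : ∑ y ∈ s, (-((M V) y)) • primeCycle y = -(M V) := by
      rw [eq_sum_smul_primeCycle_of_support_subset (-(M V)) (s := s)
        (by rw [Function.locallyFinsuppWithin.coe_neg, Function.support_neg]; exact hsupp)]
      rfl
    rw [hsum, sub_neg_eq_add, ← hMc']
    exact hMrat c' hc'
  -- a point of `X_{K(Z)}` over `[p]` (its image `i z₀` lies in `X`)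
  obtain ⟨u₀, hu₀⟩ : (pointOfVec Z.left.functionField pZ hpZ0).pt ∈ Set.range (iK N Z X i).base := by
    refine (Set.ext_iff.mp (range_iK N Z X i) _).mpr ?_
    rw [Set.mem_preimage]
    refine (Set.ext_iff.mp (range_whiskerRight_left N Z X i) _).mpr ?_
    rw [Set.mem_preimage]
    have hfst : (CartesianMonoidalCategory.fst (projectiveSpace N k) Z).left.base
        ((genericFibreι N Z).base (pointOfVec Z.left.functionField pZ hpZ0).pt) =
        (Proj.map (mapGraded k Z.left.functionField (Fin (N + 1)))
          (irrelevant_le_map k Z.left.functionField (Fin (N + 1)))).base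
          (pointOfVec Z.left.functionField pZ hpZ0).pt := by
      change ((genericFibreι N Z ≫
        (CartesianMonoidalCategory.fst (projectiveSpace N k) Z).left).base _) = _
      rw [genericFibreι_fst]
      rfl
    have hpt : (Proj.map (mapGraded k Z.left.functionField (Fin (N + 1)))
        (irrelevant_le_map k Z.left.functionField (Fin (N + 1)))).base
        (pointOfVec Z.left.functionField pZ hpZ0).pt = i.left.base z₀ := by
      rw [projMap_pt_pointOfVec (k := k) pZ hpZ0]
      change (pointOfVec k (ψ ∘ p) (comp_ne_zero ψ hp0)).pt = _
      rw [pt_pointOfVec_comp_algHom ψ p hp0, hip]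
    rw [hfst, hpt]
    exact ⟨z₀, rfl⟩
  -- independence of `pZ`, `qZ`: the points `z₀ ≠ x₀` differ
  have hpq : LinearIndependent Z.left.functionField ![pZ, qZ] := by
    by_contra hdep
    obtain ⟨c₁, hc₁, hqc⟩ := exists_eq_smul_of_not_linearIndependent hpZ0 hqZ0 hdep
    have heq : pointOfVec Z.left.functionField pZ hpZ0 = pointOfVec Z.left.functionField qZ hqZ0 :=
      (pointOfVec_eq_pointOfVec_iff pZ qZ hpZ0 hqZ0).mpr ⟨c₁, hc₁, hqc⟩
    have hzx : z₀ = x₀ := by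
      rw [← hfst_p u₀ hu₀, ← hfst_q u₀ (hu₀.trans (congrArg AlgPoints.pt heq))]
    rw [hzx, hx₀0] at hz
    exact zero_ne_one hz
  -- a single line through `[p]`, `[q]`
  have single : (∀ b (s t : Z.left.functionField),
        eval (s • pZ + t • qZ) (MvPolynomial.map (algebraMap k Z.left.functionField) (F b)) = 0) →
      ∃ e : ℕ, e ≠ 0 ∧ ∃ c' ∈ ratTrivial (X ⊗ Z).left 1, ∃ V : AlgebraicCycle (X ⊗ Z).left ℤ,
        M c' = (e : ℤ) • primeCycle z₀ + M V ∧
          ∀ z, V z ≠ 0 → IsLinePoint N i ((CartesianMonoidalCategory.fst X Z).left.base z) := by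
    intro hFpq
    obtain ⟨c', hc', uX, huX, V, hcV, hV⟩ := exists_relation_of_line Z X i hN hZ1 hpid F hrange
      ![pZ, qZ] hpq (fun b s t => hFpq b s t)
    obtain ⟨e, he, hMe⟩ := hMp (uX 0) (huX 0)
    refine ⟨e, he, c', hc', V, ?_, hV⟩
    rw [hcV, map_add, map_sub, hMe, hMq (uX 1) (huX 1), sub_zero]
  -- the three cases of Tian–Zong's two-line chain
  by_cases hpr : LinearIndependent Z.left.functionField ![pZ, mZ]
  · by_cases hqr : LinearIndependent Z.left.functionField ![qZ, mZ]
    · -- two lines `p m` and `q m`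
      obtain ⟨c₁, hc₁, uX₁, huX₁, V₁, hcV₁, hV₁⟩ := exists_relation_of_line Z X i hN hZ1 hpid F hrange
        ![pZ, mZ] hpr (fun b s t => (hrel b s t).1)
      obtain ⟨c₂, hc₂, uX₂, huX₂, V₂, hcV₂, hV₂⟩ := exists_relation_of_line Z X i hN hZ1 hpid F hrange
        ![qZ, mZ] hqr (fun b s t => (hrel b s t).2)
      obtain ⟨e, he, hMe⟩ := hMp (uX₁ 0) (huX₁ 0)
      refine ⟨e, he, c₁ - c₂, sub_mem hc₁ hc₂, V₁ - V₂, ?_, fun z hz' => ?_⟩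
      · have hinjK : Function.Injective (iK N Z X i).base := (iK N Z X i).isClosedEmbedding.injective
        have h11 : uX₁ 1 = uX₂ 1 := hinjK (by rw [huX₁ 1, huX₂ 1]; rfl)
        rw [map_sub, hcV₁, hcV₂, map_add, map_sub, map_add, map_sub, h11, hMe, hMq (uX₂ 0) (huX₂ 0),
          map_sub]
        abel
      · have : V₁ z ≠ 0 ∨ V₂ z ≠ 0 := by
          by_contra hboth
          push Not at hboth
          apply hz'
          rw [Function.locallyFinsuppWithin.coe_sub, Pi.sub_apply, hboth.1, hboth.2, sub_zero]
        rcases this with h | h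
        · exact hV₁ z h
        · exact hV₂ z h
    · -- `m` is a multiple of `q`: the single line `p q`
      obtain ⟨c₀, hc₀, hrq⟩ := exists_eq_smul_of_not_linearIndependent hqZ0 hmZ0 hqr
      refine single fun b s t => ?_
      have h := (hrel b s (t / c₀)).1
      rwa [hrq, smul_smul, div_mul_cancel₀ t hc₀] at h
  · -- `m` is a multiple of `p`: the single line `p q`
    obtain ⟨c₀, hc₀, hrp⟩ := exists_eq_smul_of_not_linearIndependent hpZ0 hmZ0 hpr
    refine single fun b s t => ?_
    have h := (hrel b t (s / c₀)).2
    rw [hrp, smul_smul, div_mul_cancel₀ s hc₀] at h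
    have hcomm : s • pZ + t • qZ = t • qZ + s • pZ := add_comm _ _
    rw [hcomm]
    exact h

end MainRat

end ProjFamily

/-! ### `CH₁(X)/⟨lines⟩` is torsion -/

section Torsion

open ProjFamily

variable {k : Type u} [Field k] [IsAlgClosed k]

/-- The saturation `{x | ∃ e > 0, e • x ∈ H}` of a subgroup `H` of an additive commutative group.
[folklore] -/
def AddSubgroup.posSmulSaturation {A : Type*} [AddCommGroup A] (H : AddSubgroup A) : AddSubgroup A where
  carrier := {x | ∃ e : ℕ, 0 < e ∧ (e : ℤ) • x ∈ H}
  add_mem' := by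
    rintro x y ⟨e₁, he₁, hx⟩ ⟨e₂, he₂, hy⟩
    refine ⟨e₁ * e₂, Nat.mul_pos he₁ he₂, ?_⟩
    rw [smul_add]
    refine H.add_mem ?_ ?_
    · rw [Nat.cast_mul, mul_comm, mul_smul]; exact H.zsmul_mem hx _
    · rw [Nat.cast_mul, mul_smul]; exact H.zsmul_mem hy _
  zero_mem' := ⟨1, one_pos, by rw [smul_zero]; exact H.zero_mem⟩
  neg_mem' := by
    rintro x ⟨e, he, hx⟩
    exact ⟨e, he, by rw [smul_neg]; exact H.neg_mem hx⟩

/-- Membership in the saturation (`Iff.rfl`). [folklore] -/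
theorem AddSubgroup.mem_posSmulSaturation {A : Type*} [AddCommGroup A] {H : AddSubgroup A} {x : A} :
    x ∈ AddSubgroup.posSmulSaturation H ↔ ∃ e : ℕ, 0 < e ∧ (e : ℤ) • x ∈ H := Iff.rfl

/-- **`CH₁(X)` is generated by lines up to torsion when `Σ_a (2 d_a - 1) ≤ N`** (the product
trick over finite extensions of function fields — Tian–Zong, Prop. 7.1 and the proof of Prop. 7.2
with chains of two lines; the surjectivity "`CH₀(F(X)) ⊗ ℚ → CH₁(X) ⊗ ℚ`" opening the proof of
Thm. 6.1, for these `X`). Let `k` be algebraically closed and `X ⊆ ℙᴺ_k` (`N ≥ 1`) a closed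
subscheme whose underlying set is `V₊(F₁, …, F_c)` for forms `F_a` of degrees `d_a ≥ 1` with
`Σ_a (2 d_a - 1) ≤ N`. Then for every class `x ∈ CH₁(X)` some positive multiple `e • x` lies in the
subgroup generated by the classes of the lines of `X`: `CH₁(X)/⟨lines⟩` is a torsion group, i.e.
`CH₁(X) ⊗ ℚ` is spanned by lines. For the named fact `TianZong2014_chowOne_generatedByLines`
(`Σ d_a ≤ N - 1`, integral coefficients) this is the rational-coefficient form in the range
`2 Σ d_a - c ≤ N` (e.g. all smooth cubic hypersurfaces of dimension `≥ 4`, all `(2, 3)` complete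
intersections in `ℙᴺ`, `N ≥ 8`); the integral statement there needs, beyond this, the divisibility
and boundedness of `CH₁(X)_alg` and Tian–Zong's Thms. 1.3 and 6.2.
[cite: TianZong2014, Prop. 7.1, proof of Prop. 7.2, proof of Thm. 6.1] -/
theorem exists_pos_smul_mem_closure_lineClasses {N : ℕ} (hN : 1 ≤ N) {X : SchemeOver k} {c : ℕ}
    (F : Fin c → MvPolynomial (Fin (N + 1)) k) (d : Fin c → ℕ) (i : X ⟶ projectiveSpace N k)
    [IsClosedImmersion i.left] (hFhom : ∀ a, (F a).IsHomogeneous (d a)) (hd : ∀ a, 0 < d a)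
    (hrange : Set.range i.left.base =
      ProjectiveSpectrum.zeroLocus (homogeneousSubmodule (Fin (N + 1)) k) (Set.range F))
    (hcount : ∑ a, (2 * (d a - 1) + 1) < N + 1) (x : ChowGroup X.left 1) :
    ∃ e : ℕ, 0 < e ∧ (e : ℤ) • x ∈ AddSubgroup.closure (lineClasses N i) := by
  haveI : IsProper (projectiveSpace N k).hom := isProper_projectiveSpace N k
  haveI : IsProper X.hom := by rw [← Over.w i]; infer_instance
  haveI : CompactSpace ↥X.left := compactSpace_of_quasiCompact_hom X
  suffices h : AddSubgroup.posSmulSaturation (AddSubgroup.closure (lineClasses N i)) = ⊤ by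
    have hx : x ∈ AddSubgroup.posSmulSaturation (AddSubgroup.closure (lineClasses N i)) := by
      rw [h]; exact AddSubgroup.mem_top x
    exact hx
  refine ChowGroup.eq_top_of_forall_ofPoint_mem fun z hz => ?_
  obtain ⟨e, he, s, w, hs, hrat⟩ := exists_pos_smul_primeCycle_ratEquiv_lines X i hN F d hFhom hd
    hrange hcount z (by simpa using hz)
  refine ⟨e, he, ?_⟩
  have hmk : (e : ℤ) • ChowGroup.ofPoint z hz =
      ChowGroup.mk X.left 1 ⟨_, sum_zsmul_primeCycle_mem_cyclesOfDim w hs⟩ := by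
    rw [ChowGroup.ofPoint, ← map_zsmul]
    exact ChowGroup.mk_eq_mk_iff.mpr hrat
  rw [hmk]
  exact mk_sum_zsmul_primeCycle_mem_closure_lineClasses w hs

/-- **`CH₁(X)/⟨lines⟩` is a torsion group** under `Σ_a (2 d_a - 1) ≤ N` (quotient form of
`exists_pos_smul_mem_closure_lineClasses`). [cite: TianZong2014, Prop. 7.1, proof of Thm. 6.1] -/
theorem isTorsion_chowGroupOne_quot_lineClasses {N : ℕ} (hN : 1 ≤ N) {X : SchemeOver k} {c : ℕ}
    (F : Fin c → MvPolynomial (Fin (N + 1)) k) (d : Fin c → ℕ) (i : X ⟶ projectiveSpace N k)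
    [IsClosedImmersion i.left] (hFhom : ∀ a, (F a).IsHomogeneous (d a)) (hd : ∀ a, 0 < d a)
    (hrange : Set.range i.left.base =
      ProjectiveSpectrum.zeroLocus (homogeneousSubmodule (Fin (N + 1)) k) (Set.range F))
    (hcount : ∑ a, (2 * (d a - 1) + 1) < N + 1) :
    AddMonoid.IsTorsion (ChowGroup X.left 1 ⧸ AddSubgroup.closure (lineClasses N i)) := by
  intro y
  induction y using QuotientAddGroup.induction_on with
  | H x =>
    obtain ⟨e, he, hx⟩ := exists_pos_smul_mem_closure_lineClasses hN F d i hFhom hd hrange hcount x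
    refine (isOfFinAddOrder_iff_nsmul_eq_zero).mpr ⟨e, he, ?_⟩
    rw [← QuotientAddGroup.mk_nsmul, QuotientAddGroup.eq_zero_iff, ← natCast_zsmul]
    exact hx

end Torsion

end Literature.AlgebraicGeometry.Motives

end
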